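import Summits.ResolutionOfSingularities.ResolutionOfSingularities.Theorems.EquisingularLiftEquisingularLiftNatStrictTransformSingularLocus
import Summits.ResolutionOfSingularities.ResolutionOfSingularities.Theorems.EquisingularLiftEquisingularLiftNatNoseResidueSingularCurvesCanonical
import HarnessLib

/-!
# [OURS · L1 W4.5(b) · EL♮(3) · D4-0d′] THE CURVE LOCK, CONSUMABLE FORM: an irreducible infinite curve not inside the centre keeps infinitely many points
# off it, so a singular curve of the running strict transform that the next centre does not contain forbids an ND-leaves end

Cell `res-hironaka`, crux EL♮(3) `EquisingularLiftNatThree` (stmt-ResolutionOfSingularities-20148), chain W4.5b, line `sections`; desk l.≈82902 «then, if still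
free, your (i) corollary as a NEW file of ✓ p659095's family».  res-L1-w45b-iso-w1 g2.  OURS; NOT a statement of any manuscript; nothing of [Hironaka2017] is
asserted; AI-written kernel bookkeeping, weaker than expert review.  Def-free, `sorry`-free, standard axioms.
`--kind proof --supports stmt-ResolutionOfSingularities-20148 --as helper`.

CONTENTS (namespace `…Cruxes.EquisingularLiftNat.Sections`):
* `infinite_diff_of_isIrreducible_of_not_subset` — in a sober Noetherian `T₀` space: `C` closed, irreducible, INFINITE, of dimension `≤ 1`, `W` closed with
  `¬ C ⊆ W` ⇒ `(C ∖ W).Infinite` (res-L1-w45b-nose-w4's ✓ `eq_of_isClosed_infinite_subset_of_dim_le_one`: an infinite closed `C ∩ W ⊊ C` is impossible, so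
  `C ∩ W` is finite).  The infinitude of `C` is a genuine hypothesis (Spec of a DVR is an irreducible 1-dimensional sober Noetherian space with two points).
* `infinite_closure_singleton_diff` — the same for `C = closure {η}` with `η ∉ W`.
* ★ `ND.not_ndInvP_strictTransform_of_singular_curve` — `X` with Noetherian underlying space, `π : X′ → X` a blow-up of the reduced closed `W`,
  `η` a point of `(closure T)~` at which it is NOT regular, `closure {η̄}` infinite of dimension `≤ 1`, `η̄ ∉ W` ⇒ `¬ ND.NDInvP n k m X′ ρ′ (closure (π⁻¹(T ∖ W)))`
  for all `m, ρ′` (✓ p659095 `ND.not_ndInvP_strictTransform_of_specializes` + the first lemma).  This is the form both residue censuses quote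
  («a singular CURVE `C ⊄ W` persists»: iso `BETA1-FINDING` (N1)–(N4), nose S_ν(4) step (1)).

HONEST SCOPE.  Bookkeeping; which centres are LEGAL is the chains' business; EL♮(3) NOT proved; dim-3 char-p resolution is in print (Cossart–Piltant); counted 0.
-/

set_option linter.dupNamespace false

noncomputable section

open CategoryTheory AlgebraicGeometry TopologicalSpace Topology IsLocalRing
open Literature.AlgebraicGeometry.Resolution
open AlgebraicGeometry.Scheme.IdealSheafData

namespace Summit.ResolutionOfSingularities.ResolutionOfSingularities.Cruxes.EquisingularLiftNat.Sections

/-- **An irreducible infinite curve not contained in a closed set keeps infinitely many points off it** (sober Noetherian `T₀` spaces): `C ∩ W` is a closed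
subset of `C`, different from `C`, hence (dimension `≤ 1`) finite; so `C ∖ W` is infinite. [OURS · L1 W4.5b · D4-0d′] -/
theorem infinite_diff_of_isIrreducible_of_not_subset {Y : Type*} [TopologicalSpace Y] [QuasiSober Y] [T0Space Y] [NoetherianSpace Y]
    {C W : Set Y} (hC : IsClosed C) (hCirr : IsIrreducible C) (hCdim : topologicalKrullDim C ≤ 1) (hCinf : C.Infinite)
    (hW : IsClosed W) (hCW : ¬ C ⊆ W) : (C \ W).Infinite := by
  intro hfin
  have hCW' : (C ∩ W).Finite := by
    by_contra hinf
    have heq := eq_of_isClosed_infinite_subset_of_dim_le_one hC hCirr hCdim (hC.inter hW) hinf Set.inter_subset_left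
    exact hCW (heq ▸ Set.inter_subset_right)
  apply hCinf
  have : C = (C ∩ W) ∪ (C \ W) := (Set.inter_union_sdiff C W).symm
  rw [this]
  exact hCW'.union hfin

/-- The same for the closure of a point `η ∉ W`. [OURS · L1 W4.5b · D4-0d′] -/
theorem infinite_closure_singleton_diff {Y : Type*} [TopologicalSpace Y] [QuasiSober Y] [T0Space Y] [NoetherianSpace Y]
    {η : Y} {W : Set Y} (hCdim : topologicalKrullDim (closure ({η} : Set Y)) ≤ 1) (hCinf : (closure ({η} : Set Y)).Infinite)
    (hW : IsClosed W) (hηW : η ∉ W) : (closure ({η} : Set Y) \ W).Infinite :=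
  infinite_diff_of_isIrreducible_of_not_subset isClosed_closure isIrreducible_singleton.closure hCdim hCinf hW
    fun h => hηW (h (subset_closure rfl))

namespace ND

/-- ★ **THE CURVE LOCK, consumable form** — `π : X′ → X` a blow-up of the reduced closed centre `W` (`X` with Noetherian underlying space), `η` a point of
the reduced closure `(closure T)~` at which it is NOT regular, whose closure `closure {η̄}` in `X` is an infinite curve (dimension `≤ 1`) with `η̄ ∉ W`: then at the
new stage `(X′, closure (π⁻¹(T ∖ W)))` the ND-leaves invariant `ND.NDInvP` fails for every measure `m` and structure map `ρ′`. [OURS · L1 W4.5b · D4-0d′] -/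
theorem not_ndInvP_strictTransform_of_singular_curve {X X' : Scheme.{0}} [NoetherianSpace X] (π : X' ⟶ X) {W : Set X} (hW : IsClosed W)
    (hπ : IsBlowup π (vanishingIdeal (⟨W, hW⟩ : Closeds X))) (T : Set X)
    (η : (vanishingIdeal (⟨closure T, isClosed_closure⟩ : Closeds X)).subscheme)
    (hη : ¬ IsRegularLocalRing ((vanishingIdeal (⟨closure T, isClosed_closure⟩ : Closeds X)).subscheme.presheaf.stalk η))
    (hCinf : (closure {((vanishingIdeal (⟨closure T, isClosed_closure⟩ : Closeds X)).subschemeι η : X)}).Infinite)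
    (hCdim : topologicalKrullDim (closure {((vanishingIdeal (⟨closure T, isClosed_closure⟩ : Closeds X)).subschemeι η : X)}) ≤ 1)
    (hηW : ((vanishingIdeal (⟨closure T, isClosed_closure⟩ : Closeds X)).subschemeι η : X) ∉ W)
    (n : ℕ) (k : Type) [Field k] (m : ℕ) (ρ' : X' ⟶ (Literature.AlgebraicGeometry.Motives.projectiveSpace n k).left) :
    ¬ NDInvP n k m X' ρ' (closure (π ⁻¹' (T \ W))) :=
  not_ndInvP_strictTransform_of_specializes π hW hπ T η hη (infinite_closure_singleton_diff hCdim hCinf hW hηW) n k m ρ'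

end ND

end Summit.ResolutionOfSingularities.ResolutionOfSingularities.Cruxes.EquisingularLiftNat.Sections

end
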